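import Summits.Ventures.YMGap.RobustBall.RobustSlabDoor
import HarnessLib

/-!
# Robust ball (Y2), area-law side, part 5b — the robust slab door in the clustering shape consumed by the criterion

HONEST FRAMING: venture file of the cell `pub-ymgap` (QuantumFields programme), track ROBUST-BALL.  The covariance form of the robust
slab door (`slab_covariance_le_W`) turned into the exact hypothesis `hcov` of `robust_slab_criterion`: for the matrix-entry observables
`φ(Q_x)_{ij}`, `ψ(Q_y⁻¹)_{kl}` (`φ, ψ ∈ {Re, Im}`) under the PERTURBED slab law `slabLawW v t β W r`,
`|Cov| ≤ (8N / c') · exp(-((-log c')/r_W) · d(x,y))`, `c' = max(c, 1/2)`, `c` the Dobrushin row-sum bound of the door and `r_W ≥ 1` the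
range of the neighbourhoods — uniformly in the rest `r`, the height, the direction and `L` (the degenerate slice `L = 1` included).
Ingredients: the triangle inequality for the slice graph distance, the profile `⌊d(·, y)/r_W⌋`, and `c^{⌊d/r_W⌋} ≤ c'^{-1} e^{(log c'/r_W) d}`.
Strong-coupling finite-lattice statement; nothing about the continuum, a mass gap, or Clay.
-/

noncomputable section

open MeasureTheory ProbabilityTheory
open scoped Matrix
open Literature.Probability.LatticeModels hiding glue
open Literature.Probability.LatticeModels.DobrushinMetric
open Literature.MathematicalPhysics.QuantumLattice (fundamentalRep continuous_fundamentalRep fundamentalRep_apply)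
open Literature.MathematicalPhysics.QuantumFieldTheory
open Literature.MathematicalPhysics.QuantumFieldTheory.DurhuusFrohlich
open Literature.MathematicalPhysics.QuantumFieldTheory.Balaban1983to89.StrongCouplingDobrushinWindow (OneLinkKRModulus)

namespace Summit.Ventures.YMGap.RobustBall

variable {n L N : ℕ} [NeZero L] {W : GaugeConfig (n + 1) L (SU N) → ℝ}

omit [NeZero L] in
/-- Triangle inequality for the graph distance of the slice torus. [cite: FriedliVelenik2017, §3.1] -/
theorem torusGraphDist_triangle (x y z : TorusSite n L) : torusGraphDist x z ≤ torusGraphDist x y + torusGraphDist y z := by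
  unfold torusGraphDist
  rw [← Finset.sum_add_distrib]
  refine Finset.sum_le_sum fun i _ => ?_
  have h : x i - z i = (x i - y i) + (y i - z i) := by ring
  rw [h]
  exact (ZMod.natAbs_valMinAbs_add_le _ _).trans (Int.natAbs_add_le _ _)

omit [NeZero L] in
/-- The profile `⌊d(·, y)/r⌋` vanishes at `y` and is 1-Lipschitz along neighbourhoods of graph-diameter `≤ r`. [folklore] -/
theorem div_profile (y : TorusSite n L) {rW : ℕ} (hrW : 1 ≤ rW) (nbr : TorusSite n L → Finset (TorusSite n L))
    (hrange : ∀ z, ∀ w ∈ nbr z, torusGraphDist z w ≤ rW) :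
    torusGraphDist y y / rW = 0 ∧ ∀ z, z ≠ y → ∀ w ∈ nbr z, torusGraphDist z y / rW ≤ torusGraphDist w y / rW + 1 := by
  refine ⟨by simp, fun z _ w hw => ?_⟩
  have h1 : torusGraphDist z y ≤ torusGraphDist w y + rW := by
    have := torusGraphDist_triangle z w y
    have := hrange z w hw
    omega
  calc torusGraphDist z y / rW ≤ (torusGraphDist w y + rW) / rW := Nat.div_le_div_right h1
    _ = torusGraphDist w y / rW + 1 := Nat.add_div_right _ (by omega)

/-- `c^{⌊d/r⌋} ≤ c'⁻¹ · e^{-((-log c')/r) d}` with `c' = max(c, 1/2)`, for `0 ≤ c ≤ 1`, `r ≥ 1`. [folklore] -/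
theorem pow_div_le_exp {c : ℝ} (hc0 : 0 ≤ c) (hc1 : c ≤ 1) {rW : ℕ} (hrW : 1 ≤ rW) (d : ℕ) :
    c ^ (d / rW) ≤ (max c (1 / 2))⁻¹ * Real.exp (-(-Real.log (max c (1 / 2)) / rW) * d) := by
  set c' : ℝ := max c (1 / 2) with hc'
  have hc'0 : 0 < c' := lt_max_of_lt_right (by norm_num)
  have hc'1 : c' ≤ 1 := max_le hc1 (by norm_num)
  have hlog : Real.log c' ≤ 0 := Real.log_nonpos hc'0.le hc'1
  set q : ℕ := d / rW with hq
  have hrW' : (0 : ℝ) < rW := by exact_mod_cast (show 0 < rW by omega)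
  -- `d < rW (q + 1)`
  have hdq : (d : ℝ) / rW ≤ q + 1 := by
    rw [div_le_iff₀ hrW']
    have h1 : d < rW * (q + 1) := by
      have := Nat.div_add_mod d rW
      have := Nat.mod_lt d (show 0 < rW by omega)
      rw [hq]; nlinarith
    have h2 : (d : ℝ) < (rW : ℝ) * (q + 1) := by exact_mod_cast h1
    linarith
  calc c ^ q ≤ c' ^ q := pow_le_pow_left₀ hc0 (le_max_left _ _) q
    _ = Real.exp (q * Real.log c') := by rw [Real.exp_nat_mul, Real.exp_log hc'0]
    _ ≤ Real.exp (-Real.log c' + Real.log c' / rW * d) := by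
        refine Real.exp_le_exp.2 ?_
        have : Real.log c' * ((q : ℝ) + 1 - d / rW) ≤ 0 := mul_nonpos_of_nonpos_of_nonneg hlog (by linarith)
        have hq' : Real.log c' / rW * d = Real.log c' * (d / rW) := by field_simp
        rw [hq']; nlinarith
    _ = c'⁻¹ * Real.exp (-(-Real.log c' / rW) * d) := by
        rw [Real.exp_add, Real.exp_neg, Real.exp_log hc'0]; ring_nf

/-- **THE ROBUST SLAB DOOR IN CLUSTERING SHAPE** (= hypothesis `hcov` of `robust_slab_criterion`, for one rest `r`).  Under the
hypotheses of `slab_covariance_le_W` (one-link modulus on the slab ball, per-site loads `δ, ℓ, Λ` of the re-weighting with row bound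
`Λ₀`, row sum `c ≤ 1`) and neighbourhoods of graph-diameter `≤ r_W` (`r_W ≥ 1`): for all sites `x, y`, indices and `φ, ψ ∈ {Re, Im}`,
`|Cov_{slabLawW}(φ(Q_x)_{ij}, ψ(Q_y⁻¹)_{kl})| ≤ (8N/c') e^{-((-log c')/r_W) d(x,y)}`, `c' = max(c, 1/2)` — constants independent of the rest,
the boundary fields, the height and `L`. [cite: CaoNissimSheffield2025dynamical, Theorem 2.3] [cite: Follmer1988, Ch. I Theorem (2.13)] -/
theorem slabLawW_entry_cov_le (hN : 1 ≤ N) (v : Fin (n + 1)) (t : ZMod L)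
    {β R K δ ℓ Λ₀ : ℝ} (hK : 0 ≤ K) (hℓ : 0 ≤ ℓ) (hR : |β| * (2 * (n : ℝ)) ≤ R) (hmod : OneLinkKRModulus N R K)
    (hWm : Measurable W) (hWb : ∃ C, ∀ U, |W U| ≤ C) (r : {e : Edge (n + 1) L // ¬ IsSlab v t e} → SU N)
    (nbrW : TorusSite n L → Finset (TorusSite n L)) (hnotW : ∀ x, x ∉ nbrW x)
    (hdep : ∀ x (η η' : TorusSite n L → SU N), (∀ z ∈ Slab.slabNbr x ∪ nbrW x, η z = η' z) →
      ∃ c : ℝ, ∀ g, siteTiltW v t W r x η g = c + siteTiltW v t W r x η' g)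
    (hδ : ∀ x ω g g', siteTiltW v t W r x ω g - siteTiltW v t W r x ω g' ≤ δ)
    (hℓ' : ∀ x ω g g', |siteTiltW v t W r x ω g - siteTiltW v t W r x ω g'| ≤ ℓ * suFrobDist g g')
    (Λ : TorusSite n L → TorusSite n L → ℝ) (hΛ0 : ∀ x y, 0 ≤ Λ x y)
    (hΛ : ∀ x y (ω η : TorusSite n L → SU N), (∀ z, z ≠ y → ω z = η z) → ∃ c : ℝ, ∀ g,
      |siteTiltW v t W r x ω g - (c + siteTiltW v t W r x η g)| ≤ Λ x y * suFrobDist (ω y) (η y))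
    (hrow : ∀ x, ∑ y ∈ Slab.slabNbr x ∪ nbrW x, Λ x y ≤ Λ₀)
    (hc1 : Real.exp δ * (1 + 2 * Real.sqrt N * ℓ) * (2 * (n : ℝ) * |β| * K) + Real.sqrt N * Λ₀ ≤ 1)
    {rW : ℕ} (hrW : 1 ≤ rW) (hrange : ∀ z, ∀ w ∈ Slab.slabNbr z ∪ nbrW z, torusGraphDist z w ≤ rW)
    (x y : TorusSite n L) (i j k l : Fin N) (φ ψ : ℂ → ℝ)
    (hφ : φ = Complex.re ∨ φ = Complex.im) (hψ : ψ = Complex.re ∨ ψ = Complex.im) :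
    |cov[fun Q => φ ((Q x : Matrix (Fin N) (Fin N) ℂ) i j),
        fun Q => ψ ((((Q y)⁻¹ : Matrix.specialUnitaryGroup (Fin N) ℂ) : Matrix (Fin N) (Fin N) ℂ) k l);
        slabLawW v t β W r]| ≤
      8 * N * (max (Real.exp δ * (1 + 2 * Real.sqrt N * ℓ) * (2 * (n : ℝ) * |β| * K) + Real.sqrt N * Λ₀) (1 / 2))⁻¹ *
        Real.exp (-(-Real.log (max (Real.exp δ * (1 + 2 * Real.sqrt N * ℓ) * (2 * (n : ℝ) * |β| * K) + Real.sqrt N * Λ₀)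
          (1 / 2)) / rW) * torusGraphDist x y) := by
  classical
  set c : ℝ := Real.exp δ * (1 + 2 * Real.sqrt N * ℓ) * (2 * (n : ℝ) * |β| * K) + Real.sqrt N * Λ₀ with hc
  have hΛ₀ : 0 ≤ Λ₀ := (Finset.sum_nonneg fun z _ => hΛ0 x z).trans (hrow x)
  have hc0 : 0 ≤ c := by positivity
  set c' : ℝ := max c (1 / 2) with hc'
  have hc'0 : 0 < c' := lt_max_of_lt_right (by norm_num)
  have hc'1 : c' ≤ 1 := max_le hc1 (by norm_num)
  haveI := isProbabilityMeasure_slabLawW (n := n) (L := L) (N := N) v t β hWm hWb r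
  obtain ⟨hfm, hfdep, hf1, hfL⟩ := Slab.entryObs_props (n := n) (L := L) x i j hφ
  obtain ⟨hgm, hgdep, hg1, hgL⟩ := Slab.invEntryObs_props (n := n) (L := L) y k l hψ
  have hN8 : (2 : ℝ) * (2 * Real.sqrt N) ^ 2 = 8 * N := by
    rw [mul_pow, Real.sq_sqrt (Nat.cast_nonneg N)]; ring
  have hNr : (1 : ℝ) ≤ N := by exact_mod_cast hN
  by_cases hL1 : L = 1
  · -- degenerate slice: one site, crude bound `|cov| ≤ 4 ≤ 8N/c'`
    subst hL1
    have hxy : x = y := Subsingleton.elim _ _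
    subst hxy
    have h4 := Slab.abs_cov_le_of_abs_le (μ := slabLawW v t β W r) hf1 hg1
    rw [torusGraphDist_self, Nat.cast_zero, mul_zero, Real.exp_zero, mul_one]
    have hinv : (1 : ℝ) ≤ c'⁻¹ := one_le_inv_iff₀.2 ⟨hc'0, hc'1⟩
    calc _ ≤ 2 * 1 * (2 * 1) := h4
      _ ≤ 8 * N * c'⁻¹ := by nlinarith
  · obtain ⟨hp0, hp⟩ := div_profile (n := n) (L := L) y hrW (fun z => Slab.slabNbr z ∪ nbrW z) hrange
    have key := slab_covariance_le_W hN hL1 v t hK hℓ hR hmod hWm hWb r nbrW hnotW hdep hδ hℓ' Λ hΛ0 hΛ hrow hc1 x y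
      hfm hfdep hf1 hfL hgm hgdep hg1 hgL (fun z => torusGraphDist z y / rW) hp0 hp
    have hexp := pow_div_le_exp hc0 hc1 hrW (torusGraphDist x y)
    calc _ ≤ 2 * (2 * Real.sqrt N) ^ 2 * 1 * (c ^ (torusGraphDist x y / rW) * 1) := key
      _ = 8 * N * c ^ (torusGraphDist x y / rW) := by rw [← hN8]; ring
      _ ≤ 8 * N * (c'⁻¹ * Real.exp (-(-Real.log c' / rW) * torusGraphDist x y)) :=
          mul_le_mul_of_nonneg_left hexp (by positivity)
      _ = 8 * N * c'⁻¹ * Real.exp (-(-Real.log c' / rW) * torusGraphDist x y) := by ring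

/-- The clustering rate of the robust slab door is positive as soon as the Dobrushin row sum is `< 1`. [folklore] -/
theorem doorRate_pos {c : ℝ} (hc1 : c < 1) {rW : ℕ} (hrW : 1 ≤ rW) : 0 < -Real.log (max c (1 / 2)) / rW := by
  have hc'0 : 0 < max c (1 / 2) := lt_max_of_lt_right (by norm_num)
  have hc'1 : max c (1 / 2) < 1 := max_lt hc1 (by norm_num)
  exact div_pos (neg_pos.2 (Real.log_neg hc'0 hc'1)) (by exact_mod_cast (show 0 < rW by omega))

end Summit.Ventures.YMGap.RobustBall
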